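import Summits.QuantumAdvantage.AdviceFreeQNC0.WalkTube
import HarnessLib

/-!
# Cell qa-qnc0 (odd primes, rung F-Q2): the walk characters over a general field `K` with a
# primitive cube root of unity — characters, multiplication rule, spans, the dual coefficient functional

α's `𝔽₄`-character toolkit (`WalkCharacters.lean`, `WalkExactLaw.lean`,
`WalkPolynomialTransforms.lean`) is written for `F4 = 𝔽₂[X]/(X²+X+1)` and uses `2 = 0` and
Frobenius.  For `𝔽_p`-players (`p ≥ 5`, planner qa-qnc0-p2 ROUND-12 §B.5, crux `WalkHardF p`) the
same calculus is needed over `K = 𝔽_p(ω)`; this file redoes the FIELD-GENERIC part for any field `K`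
and any `ω : K` with `ω² + ω + 1 = 0` and `3 ≠ 0` (then `ω³ = 1`, `ω ≠ 1`, `(ω − ω²)² = −3 ≠ 0`):

* `chiK ω a` — the character `χ_a(u) = ω^{Σ aᵢuᵢ}` of a pattern `a ∈ {1,2}^m` (letters `lett`,
  path patterns `aPat`, `conj`, `pdist` are the tree's, field-free); `omega_pow_walkExp_K` —
  `ω^{|u| + |u_{<g}|} = χ_{a^{(g)}}(u)`; `chiK_mul_chiK_self` — `χ_a² = χ_ā`.
* `ind_mul_chiK` — the multiplication rule `(ω^{aᵢ} − ω^{āᵢ})·uᵢ·χ_a = ω^{aᵢ}(χ_a − χ_{σᵢa})`;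
  `chiSpanK`, `ind_mul_mem_chiSpanK`, `mono_mul_chiK_mem` — a monomial of degree `|T|` times a
  character has spectrum within Hamming distance `|T|`.
* `LfunK ω a` — the (unnormalised) DUAL COEFFICIENT FUNCTIONAL
  `L_a(f) = Σ_u f(u)·Πᵢ W(aᵢ,uᵢ)` with weights `W(1,0) = −ω², W(1,1) = 1, W(2,0) = ω, W(2,1) = −1`
  (NOT the `𝔽₄` formula, which needs `2 = 0`): `LfunK_chiK` — `L_a(χ_b) = [a = b]·(ω − ω²)^m`;
  `LfunK_eq_zero_of_mem` — `L_a` kills spans of characters avoiding `a`; `LfunK_mono` —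
  `L_a(u^S) = Π_{i∈S} σ(aᵢ) · Π_{i∉S} κ(aᵢ)` with `σ = ±1`, `κ ∈ {1 − ω², ω − 1}` (a PRODUCT — the
  input of the rank form `WalkTubeRankK.lean`).

Purpose (prover memo HOME/qa-qnc0-prover/PROVER-MEMO-gen10.md §3 (R1)): the tube bound for
≤2-shot `𝔽_p`-strategies.  WHAT THIS IS NOT: no statement about the game; no separation claim.
-/

noncomputable section

namespace Summit.QuantumAdvantage.AdviceFreeQNC0

open Finset
open Literature.Computability.MetaComplexity Literature.Computability.MetaComplexity.Smolensky

namespace CharK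

variable {K : Type*} [Field K]

/-! ### Consequences of `ω² + ω + 1 = 0`, `3 ≠ 0` -/

section Omega

variable {ω : K} (hω : ω ^ 2 + ω + 1 = 0)
include hω

/-- `ω³ = 1`. -/
theorem omega_cube : ω ^ 3 = 1 := by
  linear_combination (ω - 1) * hω

/-- `ω^k = ω^{k mod 3}`. -/
theorem omega_pow_mod (k : ℕ) : ω ^ k = ω ^ (k % 3) := by
  conv_lhs => rw [← Nat.div_add_mod k 3, pow_add, pow_mul, omega_cube hω, one_pow, one_mul]

/-- `ω ≠ 0`. -/
theorem omega_ne_zero : ω ≠ 0 := by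
  intro h
  rw [h] at hω
  norm_num at hω

/-- `ω ≠ 1` (as `3 ≠ 0`). -/
theorem omega_ne_one (h3 : (3 : K) ≠ 0) : ω ≠ 1 := by
  intro h
  rw [h] at hω
  apply h3
  linear_combination hω

/-- `(ω − ω²)² = −3`. -/
theorem omega_sub_sq : (ω - ω ^ 2) ^ 2 = -3 := by
  linear_combination (ω ^ 2 - 3 * ω + 3) * hω

/-- `ω − ω² ≠ 0`. -/
theorem omega_sub_ne_zero (h3 : (3 : K) ≠ 0) : ω - ω ^ 2 ≠ 0 := by
  intro h
  have := omega_sub_sq hω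
  rw [h] at this
  apply h3
  linear_combination this

/-- `1 − ω² ≠ 0`. -/
theorem one_sub_omega_sq_ne_zero (h3 : (3 : K) ≠ 0) : 1 - ω ^ 2 ≠ 0 := by
  intro h
  have h1 : ω ^ 2 = 1 := by linear_combination -h
  have h2 : ω = -2 := by linear_combination hω - h1
  apply h3
  have : ω ^ 2 = 4 := by rw [h2]; norm_num
  linear_combination h1 - this

/-- `ω − 1 ≠ 0`. -/
theorem omega_sub_one_ne_zero (h3 : (3 : K) ≠ 0) : ω - 1 ≠ 0 :=
  sub_ne_zero.2 (omega_ne_one hω h3)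

end Omega

/-! ### Characters -/

variable {m : ℕ}

/-- The indicator `{false, true} ↦ {0, 1} ⊂ K`. -/
def ιK (K : Type*) [Field K] (b : Bool) : K := if b then 1 else 0

/-- The character `χ_a(u) = ω^{Σᵢ aᵢ uᵢ}` of a pattern `a ∈ {1,2}^m`, over `K`. -/
def chiK (ω : K) (a : Fin m → Bool) (u : Fin m → Bool) : K := ∏ i, (if u i then ω ^ lett (a i) else 1)

/-- **The walk character is a path character**: `ω^{|u| + |u_{<g}|} = χ_{a^{(g)}}(u)`. -/
theorem omega_pow_walkExp_K (ω : K) (u : Fin m → Bool) (g : ℕ) :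
    ω ^ walkExp u g = chiK ω (aPat g) u := by
  classical
  unfold walkExp wt wtPrefix chiK
  rw [Finset.card_filter, Finset.card_filter, ← Finset.sum_add_distrib, ← Finset.prod_pow_eq_pow_sum]
  refine Finset.prod_congr rfl fun i _ => ?_
  unfold aPat lett
  by_cases hu : u i = true
  · by_cases hi : i.val < g
    · rw [if_pos hu, if_pos ⟨hi, hu⟩, if_pos hu, if_pos (decide_eq_true hi)]
    · rw [if_pos hu, if_neg (fun h => hi h.1), if_pos hu, if_neg (by rw [decide_eq_true_iff]; exact hi)]
  · rw [if_neg hu, if_neg (fun h => hu h.2), if_neg hu, Nat.add_zero, pow_zero]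

/-- `χ_a(u)² = χ_ā(u)` (uses only `ω³ = 1`). -/
theorem chiK_sq {ω : K} (hω : ω ^ 2 + ω + 1 = 0) (a u : Fin m → Bool) :
    chiK ω a u ^ 2 = chiK ω (conj a) u := by
  unfold chiK conj
  rw [← Finset.prod_pow]
  refine Finset.prod_congr rfl fun i _ => ?_
  by_cases hu : u i = true
  · rw [if_pos hu, if_pos hu, ← pow_mul]
    unfold lett
    cases a i
    · simp only [Bool.false_eq_true, if_false, Bool.not_false, if_true, Nat.one_mul]
    · simp only [if_true, Bool.not_true, Bool.false_eq_true, if_false]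
      rw [omega_pow_mod hω (2 * 2), show 2 * 2 % 3 = 1 from rfl]
  · rw [if_neg hu, if_neg hu, one_pow]

/-- `χ_a(u) · χ_a(u)² = 1` pointwise: characters are units. -/
theorem chiK_mul_chiK_sq {ω : K} (hω : ω ^ 2 + ω + 1 = 0) (a u : Fin m → Bool) :
    chiK ω a u * chiK ω a u ^ 2 = 1 := by
  rw [← pow_succ', show 2 + 1 = 3 from rfl]
  unfold chiK
  rw [← Finset.prod_pow]
  refine Finset.prod_eq_one fun i _ => ?_
  by_cases hu : u i = true
  · rw [if_pos hu, ← pow_mul, mul_comm, pow_mul, omega_cube hω, one_pow]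
  · rw [if_neg hu, one_pow]

/-- **The multiplication rule**: `(ω^{aᵢ} − ω^{āᵢ}) · uᵢ · χ_a(u) = ω^{aᵢ} · (χ_a(u) − χ_{σᵢ a}(u))`. -/
theorem ind_mul_chiK (ω : K) (a : Fin m → Bool) (i : Fin m) (u : Fin m → Bool) :
    (ω ^ lett (a i) - ω ^ lett (!a i)) * (ιK K (u i) * chiK ω a u) =
      ω ^ lett (a i) * (chiK ω a u - chiK ω (Function.update a i (!a i)) u) := by
  classical
  have split : ∀ c : Fin m → Bool, chiK ω c u =
      (if u i = true then ω ^ lett (c i) else 1) *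
        ∏ j ∈ univ.erase i, (if u j = true then ω ^ lett (c j) else 1) :=
    fun c => (Finset.mul_prod_erase univ (fun j => if u j = true then ω ^ lett (c j) else 1)
      (Finset.mem_univ i)).symm
  have hrest : ∏ j ∈ univ.erase i, (if u j = true then ω ^ lett (Function.update a i (!a i) j) else 1) =
      ∏ j ∈ univ.erase i, (if u j = true then ω ^ lett (a j) else 1) :=
    Finset.prod_congr rfl fun j hj => by rw [Function.update_of_ne (Finset.ne_of_mem_erase hj)]
  rw [split a, split (Function.update a i (!a i)), hrest, Function.update_self]
  unfold ιK
  by_cases hu : u i = true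
  · rw [if_pos hu, if_pos hu, if_pos hu]
    ring
  · rw [if_neg hu, if_neg hu, if_neg hu]
    ring

/-! ### Spans of characters -/

/-- The `K`-span of the characters `χ_a` with `P a`. -/
def chiSpanK (ω : K) (P : (Fin m → Bool) → Prop) : Submodule K ((Fin m → Bool) → K) :=
  Submodule.span K {f | ∃ a, P a ∧ f = chiK ω a}

/-- Generators lie in the span. -/
theorem chiK_mem_chiSpanK {ω : K} {P : (Fin m → Bool) → Prop} {a : Fin m → Bool} (h : P a) :
    chiK ω a ∈ chiSpanK ω P :=
  Submodule.subset_span ⟨a, h, rfl⟩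

/-- Monotonicity in the predicate. -/
theorem chiSpanK_mono {ω : K} {P Q : (Fin m → Bool) → Prop} (h : ∀ a, P a → Q a) :
    chiSpanK ω P ≤ chiSpanK ω Q := by
  refine Submodule.span_mono ?_
  rintro f ⟨a, ha, rfl⟩
  exact ⟨a, h a ha, rfl⟩

/-- **Multiplying by `uᵢ` moves the spectrum by at most one letter.** -/
theorem ind_mul_mem_chiSpanK {ω : K} (hω : ω ^ 2 + ω + 1 = 0) (h3 : (3 : K) ≠ 0)
    (b : Fin m → Bool) (i : Fin m) (k : ℕ) {f : (Fin m → Bool) → K}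
    (hf : f ∈ chiSpanK ω fun a => pdist a b ≤ k) :
    (fun u => ιK K (u i) * f u) ∈ chiSpanK ω fun a => pdist a b ≤ k + 1 := by
  unfold chiSpanK at hf
  induction hf using Submodule.span_induction with
  | mem g hg =>
    obtain ⟨a, ha, rfl⟩ := hg
    -- the letter difference is a unit
    have hd : ω ^ lett (a i) - ω ^ lett (!a i) ≠ 0 := by
      unfold lett
      cases a i
      · simp only [Bool.false_eq_true, if_false, pow_one, Bool.not_false, if_true]
        exact omega_sub_ne_zero hω h3
      · simp only [if_true, Bool.not_true, Bool.false_eq_true, if_false, pow_one]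
        intro h
        exact omega_sub_ne_zero hω h3 (by linear_combination -h)
    have e : (fun u => ιK K (u i) * chiK ω a u) =
        ((ω ^ lett (a i) - ω ^ lett (!a i))⁻¹ * ω ^ lett (a i)) •
          (chiK ω a - chiK ω (Function.update a i (!a i))) := by
      funext u
      rw [Pi.smul_apply, Pi.sub_apply, smul_eq_mul, mul_assoc, ← ind_mul_chiK, ← mul_assoc,
        inv_mul_cancel₀ hd, one_mul]
    rw [e]
    refine Submodule.smul_mem _ _ (Submodule.sub_mem _ (chiK_mem_chiSpanK (by omega)) ?_)
    exact chiK_mem_chiSpanK (le_trans (pdist_update_le a b i) (by omega))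
  | zero =>
    have e : (fun u : Fin m → Bool => ιK K (u i) * (0 : (Fin m → Bool) → K) u) = 0 := by
      funext u; simp
    rw [e]; exact Submodule.zero_mem _
  | add g h _ _ hg hh =>
    have e : (fun u => ιK K (u i) * (g + h) u) =
        (fun u => ιK K (u i) * g u) + fun u => ιK K (u i) * h u := by
      funext u; simp [mul_add]
    rw [e]; exact Submodule.add_mem _ hg hh
  | smul c g _ hg =>
    have e : (fun u => ιK K (u i) * (c • g) u) = c • fun u => ιK K (u i) * g u := by
      funext u; simp [smul_eq_mul]; ring
    rw [e]; exact Submodule.smul_mem _ _ hg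

/-- The tree's monomial `Smolensky.mono K T` is the product of the indicators. -/
theorem mono_eq_prod_ιK (T : Finset (Fin m)) (u : Fin m → Bool) :
    mono K T u = ∏ i ∈ T, ιK K (u i) := rfl

/-- **A monomial of degree `|T|` times a character has spectrum within distance `|T|`.** -/
theorem mono_mul_chiK_mem {ω : K} (hω : ω ^ 2 + ω + 1 = 0) (h3 : (3 : K) ≠ 0)
    (T : Finset (Fin m)) (b : Fin m → Bool) :
    (fun u => mono K T u * chiK ω b u) ∈ chiSpanK ω fun a => pdist a b ≤ T.card := by
  classical
  induction T using Finset.induction_on with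
  | empty =>
    have e : (fun u => mono K (∅ : Finset (Fin m)) u * chiK ω b u) = chiK ω b := by
      funext u; simp [mono]
    rw [e]
    exact chiK_mem_chiSpanK (by simp [pdist])
  | insert i T hi ih =>
    have e : (fun u => mono K (insert i T) u * chiK ω b u) =
        fun u => ιK K (u i) * (mono K T u * chiK ω b u) := by
      funext u
      rw [mono_eq_prod_ιK, mono_eq_prod_ιK, Finset.prod_insert hi, mul_assoc]
    rw [e, Finset.card_insert_of_notMem hi]
    exact ind_mul_mem_chiSpanK hω h3 b i T.card ih

/-! ### The dual coefficient functional -/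

/-- The dual weights: `W(1,0) = −ω²`, `W(1,1) = 1`, `W(2,0) = ω`, `W(2,1) = −1`
(first argument the pattern letter `aᵢ`, second the input bit `uᵢ`). -/
def dualW (ω : K) (ai ui : Bool) : K :=
  if ai then (if ui then -1 else ω) else (if ui then 1 else -ω ^ 2)

/-- `L_a(f) = Σ_u f(u) · Πᵢ W(aᵢ, uᵢ)`. -/
def LfunK (ω : K) (a : Fin m → Bool) (f : (Fin m → Bool) → K) : K :=
  ∑ u, f u * ∏ i, dualW ω (a i) (u i)

/-- `L_a` is additive. -/
theorem LfunK_add (ω : K) (a : Fin m → Bool) (f g : (Fin m → Bool) → K) :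
    LfunK ω a (f + g) = LfunK ω a f + LfunK ω a g := by
  unfold LfunK
  rw [← Finset.sum_add_distrib]
  exact Finset.sum_congr rfl fun u _ => by rw [Pi.add_apply, add_mul]

/-- `L_a` is homogeneous. -/
theorem LfunK_smul (ω : K) (a : Fin m → Bool) (c : K) (f : (Fin m → Bool) → K) :
    LfunK ω a (c • f) = c * LfunK ω a f := by
  unfold LfunK
  rw [Finset.mul_sum]
  exact Finset.sum_congr rfl fun u _ => by rw [Pi.smul_apply, smul_eq_mul, mul_assoc]

/-- `L_a` as a `K`-linear map. -/
def LfunKLin (ω : K) (a : Fin m → Bool) : ((Fin m → Bool) → K) →ₗ[K] K where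
  toFun := LfunK ω a
  map_add' := LfunK_add ω a
  map_smul' c f := by rw [LfunK_smul, RingHom.id_apply, smul_eq_mul]

/-- Pointwise formula for `LfunKLin`. -/
theorem LfunKLin_apply (ω : K) (a : Fin m → Bool) (f : (Fin m → Bool) → K) :
    LfunKLin ω a f = LfunK ω a f := rfl

/-- One coordinate of `L_a(χ_b)`: `Σ_{uᵢ} χ-factor · W(aᵢ,uᵢ) = [aᵢ = bᵢ]·(ω − ω²)`. -/
private theorem dual_pair (ω : K) (ai bi : Bool) :
    (∑ ub : Bool, (if ub = true then ω ^ lett bi else 1) * dualW ω ai ub) =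
      if ai = bi then ω - ω ^ 2 else 0 := by
  rw [Fintype.sum_bool]
  unfold lett dualW
  cases ai <;> cases bi
  · simp; ring
  · simp
  · simp
  · simp; ring

/-- **`L_a` picks the coefficient of `χ_a`**: `L_a(χ_b) = [a = b]·(ω − ω²)^m`. -/
theorem LfunK_chiK (ω : K) (a b : Fin m → Bool) :
    LfunK ω a (chiK ω b) = if a = b then (ω - ω ^ 2) ^ m else 0 := by
  classical
  unfold LfunK chiK
  have e : ∀ u : Fin m → Bool,
      (∏ i, (if u i = true then ω ^ lett (b i) else 1)) * ∏ i, dualW ω (a i) (u i) =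
        ∏ i, ((if u i = true then ω ^ lett (b i) else 1) * dualW ω (a i) (u i)) := by
    intro u
    rw [← Finset.prod_mul_distrib]
  rw [Finset.sum_congr rfl fun u _ => e u]
  have h := Finset.prod_univ_sum (fun _ : Fin m => (univ : Finset Bool))
    (fun i bb => (if bb = true then ω ^ lett (b i) else 1) * dualW ω (a i) bb)
  rw [Fintype.piFinset_univ] at h
  rw [← h]
  simp_rw [dual_pair ω]
  by_cases hab : a = b
  · rw [if_pos hab, hab]
    simp
  · rw [if_neg hab]
    obtain ⟨i, hi⟩ : ∃ i, a i ≠ b i := Function.ne_iff.mp hab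
    exact Finset.prod_eq_zero (Finset.mem_univ i) (if_neg hi)

/-- `L_a` vanishes on the span of characters `χ_b` with `¬ P a`. -/
theorem LfunK_eq_zero_of_mem (ω : K) {P : (Fin m → Bool) → Prop}
    {a : Fin m → Bool} (ha : ¬ P a) {f : (Fin m → Bool) → K} (hf : f ∈ chiSpanK ω P) :
    LfunK ω a f = 0 := by
  unfold chiSpanK at hf
  induction hf using Submodule.span_induction with
  | mem g hg =>
    obtain ⟨b, hb, rfl⟩ := hg
    rw [LfunK_chiK ω, if_neg]
    rintro rfl
    exact ha hb
  | zero => simp [LfunK]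
  | add g h _ _ hg hh => rw [LfunK_add, hg, hh, add_zero]
  | smul c g _ hg => rw [LfunK_smul, hg, mul_zero]

/-- The sign of a letter: `σ(1) = 1`, `σ(2) = −1` (`= W(·,1)`). -/
def sgnW (ai : Bool) : K := if ai then -1 else 1

/-- The column sum of a letter: `κ(1) = 1 − ω²`, `κ(2) = ω − 1` (`= W(·,0) + W(·,1)`). -/
def kapW (ω : K) (ai : Bool) : K := if ai then ω - 1 else 1 - ω ^ 2

/-- `κ(aᵢ) ≠ 0`. -/
theorem kapW_ne_zero {ω : K} (hω : ω ^ 2 + ω + 1 = 0) (h3 : (3 : K) ≠ 0) (ai : Bool) :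
    kapW ω ai ≠ 0 := by
  unfold kapW
  cases ai
  · exact one_sub_omega_sq_ne_zero hω h3
  · exact omega_sub_one_ne_zero hω h3

/-- **`L_a` of a monomial is a product**: `L_a(u^S) = Π_{i∈S} σ(aᵢ) · Π_{i∉S} κ(aᵢ)`. -/
theorem LfunK_mono (ω : K) (a : Fin m → Bool) (S : Finset (Fin m)) :
    LfunK ω a (mono K S) = (∏ i ∈ S, sgnW (a i)) * ∏ i ∈ univ \ S, kapW ω (a i) := by
  classical
  unfold LfunK
  have e : ∀ u : Fin m → Bool, mono K S u * ∏ i, dualW ω (a i) (u i) =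
      ∏ i, ((if i ∈ S then ιK K (u i) else 1) * dualW ω (a i) (u i)) := by
    intro u
    rw [Finset.prod_mul_distrib]
    congr 1
    rw [mono_eq_prod_ιK, ← Finset.prod_filter, Finset.filter_mem_eq_inter, Finset.univ_inter]
  rw [Finset.sum_congr rfl fun u _ => e u]
  have h := Finset.prod_univ_sum (fun _ : Fin m => (univ : Finset Bool))
    (fun i bb => (if i ∈ S then ιK K bb else 1) * dualW ω (a i) bb)
  rw [Fintype.piFinset_univ] at h
  rw [← h]
  have hfac : ∀ i : Fin m,
      (∑ bb : Bool, (if i ∈ S then ιK K bb else 1) * dualW ω (a i) bb) =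
        if i ∈ S then sgnW (a i) else kapW ω (a i) := by
    intro i
    rw [Fintype.sum_bool]
    unfold ιK dualW sgnW kapW
    by_cases hi : i ∈ S
    · simp only [hi, if_true, Bool.false_eq_true, if_false, one_mul, zero_mul, add_zero]
    · simp only [hi, if_false, one_mul, Bool.false_eq_true]
      cases a i <;> simp <;> ring
  simp_rw [hfac]
  rw [Finset.prod_ite, Finset.filter_mem_eq_inter, Finset.univ_inter, Finset.filter_not,
    Finset.filter_mem_eq_inter, Finset.univ_inter]

end CharK

end Summit.QuantumAdvantage.AdviceFreeQNC0

end
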